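import Literature.NumberTheory.QuadraticFields.ReducedQuadraticIrrationalsCycle
import Mathlib.NumberTheory.DiophantineApproximation.Basic
import HarnessLib

/-!
# Reduced quadratic irrationals, III: convergents and the numbers `θ = A − Bφ̄`

Topic `NumberTheory/QuadraticFields`; continues `ReducedQuadraticIrrationalsCycle.lean`.
Theorem-only file (no definitions, no named facts). For the expansion `x₀, x₁ = step x₀, …` of a
pre-reduced quadratic irrational `φ₀ = val x₀` we identify Jacobson–Williams' numbers
`θ_{n+2} = A_n − B_n φ̄₀` (op. cit. §3.1, before (3.15)), where `A_n/B_n` is the `n`-th convergent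
of `φ₀`, with the products `∏_{k=1}^{n+1} ψ_k` (op. cit. (3.16)–(3.17)):

* `one_le_convergent` — the convergents of an irrational `ξ > 1` are `≥ 1`;
* `num_den_intCast_add_inv` — lowest terms of `q₀ + 1/r` for a rational `r > 0`;
* **`num_sub_den_mul_conj`**: `A_n − B_n φ̄₀ = ∏_{k=1}^{n+1} ψ_k` and its conjugate
  **`num_sub_den_mul_val`**: `A_n − B_n φ₀ = ∏_{k=1}^{n+1} ψ̄_k` (op. cit. (3.16)–(3.17) with
  (3.10)), by induction along Mathlib's recursion `Real.convergent_succ`;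
* **`exists_eq_psiProd_of_abs_sub_lt`** — Legendre's theorem (op. cit. Thm. 3.2, Mathlib's
  `Real.exists_rat_eq_convergent`) in this language: if `|φ₀ − u/z| < 1/(2z²)` with `gcd(u, z) = 1`,
  `z ≥ 1`, then `u − zφ̄₀ = ∏_{k=1}^{n+1} ψ_k` and `u − zφ₀ = ∏_{k=1}^{n+1} ψ̄_k` for some `n`.

The convergents are Mathlib's `Real.convergent` (`Mathlib.NumberTheory.DiophantineApproximation.Basic`),
so no continuant bookkeeping `(A_n, B_n)` of our own is introduced.

## References

* M. J. Jacobson, Jr., H. C. Williams, *Solving the Pell Equation*, CMS Books in Mathematics,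
  Springer (2009), §3.1 (3.6)–(3.10), (3.15)–(3.17); §3.2 Thms. 3.1–3.2. [JacobsonWilliams2008]
-/

noncomputable section

open scoped Classical

namespace Literature.NumberTheory.QuadraticFields

namespace QuadIrr

variable {D : ℕ}

/-! ### Convergents of a real number greater than one -/

/-- The convergents of an irrational `ξ > 1` are all `≥ 1`. [cite: JacobsonWilliams2008, §3.2 (B_i ≥ 1, A_i/B_i ≥ q_0)] -/
theorem one_le_convergent {ξ : ℝ} (hξ : Irrational ξ) (h1 : 1 < ξ) (n : ℕ) : 1 ≤ ξ.convergent n := by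
  induction n generalizing ξ with
  | zero =>
    rw [Real.convergent_zero]
    have : (1 : ℤ) ≤ ⌊ξ⌋ := by
      have := Int.floor_mono h1.le
      simpa using this
    exact_mod_cast this
  | succ n ih =>
    rw [Real.convergent_succ]
    have hfl : (1 : ℤ) ≤ ⌊ξ⌋ := by
      have := Int.floor_mono h1.le
      simpa using this
    have hfr0 : 0 < Int.fract ξ := Int.fract_pos.mpr fun h => hξ.ne_int ⌊ξ⌋ h
    have hfr1 : Int.fract ξ < 1 := Int.fract_lt_one ξ
    have hξ' : Irrational (Int.fract ξ)⁻¹ := by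
      rw [Int.fract]
      exact (hξ.sub_intCast _).inv
    have h1' : 1 < (Int.fract ξ)⁻¹ := (one_lt_inv₀ hfr0).mpr hfr1
    have hc := ih hξ' h1'
    have hcpos : 0 < ((Int.fract ξ)⁻¹.convergent n)⁻¹ := inv_pos.mpr (by linarith)
    have : (1 : ℚ) ≤ ⌊ξ⌋ := by exact_mod_cast hfl
    linarith

/-- **Lowest terms of `q₀ + 1/r`** for an integer `q₀` and a rational `r > 0`: numerator
`q₀ · num r + den r`, denominator `num r` (the recurrence (3.3) read off Mathlib's recursion for
convergents). [cite: JacobsonWilliams2008, §3.1 (3.3)–(3.5)] -/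
theorem num_den_intCast_add_inv (q₀ : ℤ) {r : ℚ} (hr : 0 < r) :
    ((q₀ : ℚ) + r⁻¹).num = q₀ * r.num + r.den ∧ ((((q₀ : ℚ) + r⁻¹).den : ℕ) : ℤ) = r.num := by
  have hnum : 0 < r.num := Rat.num_pos.mpr hr
  have hcop : IsCoprime (r.den : ℤ) r.num := by
    rw [Int.isCoprime_iff_gcd_eq_one, Int.gcd_eq_natAbs, Int.natAbs_natCast]
    exact r.reduced.symm
  have hcop' : IsCoprime (q₀ * r.num + r.den) r.num := by
    have := hcop.add_mul_right_left q₀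
    rwa [add_comm] at this
  have hnat : Nat.Coprime (q₀ * r.num + r.den).natAbs r.num.natAbs := by
    have := Int.isCoprime_iff_gcd_eq_one.mp hcop'
    rwa [Int.gcd_eq_natAbs] at this
  have heq : (q₀ : ℚ) + r⁻¹ = ((q₀ * r.num + r.den : ℤ) : ℚ) / (r.num : ℚ) := by
    have hr' : (r.num : ℚ) ≠ 0 := by exact_mod_cast hnum.ne'
    conv_lhs => rw [← Rat.num_div_den r]
    have hd : (r.den : ℚ) ≠ 0 := by exact_mod_cast r.den_nz
    push_cast
    field_simp
  rw [heq]
  exact ⟨Rat.num_div_eq_of_coprime hnum hnat, Rat.den_div_eq_of_coprime hnum hnat⟩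

/-! ### `θ = A − B φ̄` as a product of the `ψ_k` -/

/-- `∏_{k=1}^{n+1} ψ_k(x₀) = ψ(x₁) · ∏_{k=1}^{n} ψ_k(x₁)`. [cite: JacobsonWilliams2008, §3.1 (3.17)] -/
theorem psiProd_succ' (x₀ : QuadIrr D) (n : ℕ) :
    psiProd x₀ (n + 1) = psi (step x₀) * psiProd (step x₀) n := by
  unfold psiProd
  rw [Finset.prod_range_succ', mul_comm]
  simp only [zero_add, Function.iterate_succ_apply, Function.iterate_zero, id_eq]

/-- `∏_{k=1}^{n+1} ψ̄_k(x₀) = ψ̄(x₁) · ∏_{k=1}^{n} ψ̄_k(x₁)`. [cite: JacobsonWilliams2008, §3.1 (3.18)] -/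
theorem psiBarProd_succ' (x₀ : QuadIrr D) (n : ℕ) :
    psiBarProd x₀ (n + 1) = psiBar (step x₀) * psiBarProd (step x₀) n := by
  unfold psiBarProd
  rw [Finset.prod_range_succ', mul_comm]
  simp only [zero_add, Function.iterate_succ_apply, Function.iterate_zero, id_eq]

/-- `∏_{k=1}^{n+1} φ_k(x₀) = φ(x₁) · ∏_{k=1}^{n} φ_k(x₁)`. [cite: JacobsonWilliams2008, §3.1 (3.17)] -/
theorem valProd_succ' (x₀ : QuadIrr D) (n : ℕ) :
    valProd x₀ (n + 1) = (step x₀).val * valProd (step x₀) n := by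
  unfold valProd
  rw [Finset.prod_range_succ', mul_comm]
  simp only [zero_add, Function.iterate_succ_apply, Function.iterate_zero, id_eq]

/-- `1/fract φ = φ'`: Mathlib's recursion for convergents steps along `step`. [cite: JacobsonWilliams2008, §3.1 (3.2)] -/
theorem inv_fract_val (hD : ¬ IsSquare D) {x : QuadIrr D} (h : x.IsAdmissible) :
    (Int.fract x.val)⁻¹ = (step x).val := by
  rw [val_step hD h, Int.fract, one_div]
  rfl

/-- **`A_n − B_n φ̄₀ = ∏_{k=1}^{n+1} ψ_k`** for a pre-reduced `x₀`, where `A_n/B_n` is the `n`-th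
convergent of `φ₀ = val x₀` in lowest terms (Jacobson–Williams' `θ_{n+2} = ∏ ψ_k`, (3.16)–(3.17)
with `θ_{j+2} = A_j − B_j φ̄₀`). [cite: JacobsonWilliams2008, §3.1 (3.15)–(3.17)] -/
theorem num_sub_den_mul_conj (hD : ¬ IsSquare D) {x : QuadIrr D} (h : x.IsPreReduced) (n : ℕ) :
    ((x.val.convergent n).num : ℝ) - (x.val.convergent n).den * x.conj = psiProd x (n + 1) := by
  induction n generalizing x with
  | zero =>
    rw [Real.convergent_zero, Rat.num_intCast, Rat.den_intCast, psiProd_succ', psiProd,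
      Finset.prod_range_zero, mul_one, psi_step hD h.isAdmissible]
    simp [pq]
  | succ n ih =>
    have hadm := h.isAdmissible
    have h' : (step x).IsPreReduced := (h.isReduced_step hD).isPreReduced
    rw [Real.convergent_succ, inv_fract_val hD hadm, psiProd_succ', ← ih h']
    set r := (step x).val.convergent n with hr
    have hrpos : 0 < r := lt_of_lt_of_le one_pos
      (one_le_convergent (irrational_val hD h'.isAdmissible.1) h'.2.2.1 n)
    obtain ⟨hnum, hden⟩ := num_den_intCast_add_inv ⌊x.val⌋ hrpos
    have hden' : (((⌊x.val⌋ : ℚ) + r⁻¹).den : ℝ) = r.num := by exact_mod_cast hden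
    rw [hnum, hden']
    push_cast
    rw [conj_step hD hadm, psi_step hD hadm]
    simp only [pq]
    have h1 : (⌊x.val⌋ : ℝ) - x.conj ≠ 0 := by
      have := (h.isReduced_step hD).one_lt_psi
      rw [psi_step hD hadm] at this
      simp only [pq] at this
      intro h0
      linarith
    have h2 : x.conj - (⌊x.val⌋ : ℝ) ≠ 0 := fun h0 => h1 (by linarith)
    field_simp
    ring

/-- **`A_n − B_n φ₀ = ∏_{k=1}^{n+1} ψ̄_k`** (the conjugate identity, op. cit. (3.10)/(3.17)).
[cite: JacobsonWilliams2008, §3.1 (3.10), (3.17)] -/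
theorem num_sub_den_mul_val (hD : ¬ IsSquare D) {x : QuadIrr D} (h : x.IsPreReduced) (n : ℕ) :
    ((x.val.convergent n).num : ℝ) - (x.val.convergent n).den * x.val = psiBarProd x (n + 1) := by
  induction n generalizing x with
  | zero =>
    rw [Real.convergent_zero, Rat.num_intCast, Rat.den_intCast, psiBarProd_succ', psiBarProd,
      Finset.prod_range_zero, mul_one, psiBar_step hD h.isAdmissible]
    simp [pq]
  | succ n ih =>
    have hadm := h.isAdmissible
    have h' : (step x).IsPreReduced := (h.isReduced_step hD).isPreReduced
    rw [Real.convergent_succ, inv_fract_val hD hadm, psiBarProd_succ', ← ih h']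
    set r := (step x).val.convergent n with hr
    have hrpos : 0 < r := lt_of_lt_of_le one_pos
      (one_le_convergent (irrational_val hD h'.isAdmissible.1) h'.2.2.1 n)
    obtain ⟨hnum, hden⟩ := num_den_intCast_add_inv ⌊x.val⌋ hrpos
    have hden' : (((⌊x.val⌋ : ℚ) + r⁻¹).den : ℝ) = r.num := by exact_mod_cast hden
    rw [hnum, hden']
    push_cast
    rw [val_step hD hadm, psiBar_step hD hadm]
    simp only [pq]
    have h1 : x.val - (⌊x.val⌋ : ℝ) ≠ 0 := sub_ne_zero.mpr ((irrational_val hD hadm.1).ne_int _)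
    have h2 : (⌊x.val⌋ : ℝ) - x.val ≠ 0 := fun h0 => h1 (by linarith)
    field_simp
    ring

/-- **Legendre's theorem along the expansion**: if `|φ₀ − u/z| < 1/(2z²)` with `gcd(u, z) = 1` and
`z ≥ 1`, then `u/z` is a convergent of `φ₀` (Mathlib's `Real.exists_rat_eq_convergent`,
op. cit. Thm. 3.2), hence `u − zφ̄₀ = ∏_{k=1}^{n+1} ψ_k` and `u − zφ₀ = ∏_{k=1}^{n+1} ψ̄_k` for
some `n`. [cite: JacobsonWilliams2008, §3.2 Thm. 3.2 with §3.1 (3.17)] -/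
theorem exists_eq_psiProd_of_abs_sub_lt (hD : ¬ IsSquare D) {x : QuadIrr D} (h : x.IsPreReduced)
    {u z : ℤ} (hz : 0 < z) (hcop : IsCoprime u z)
    (happrox : |x.val - u / z| < 1 / (2 * (z : ℝ) ^ 2)) :
    ∃ n : ℕ, (u : ℝ) - z * x.conj = psiProd x (n + 1) ∧ (u : ℝ) - z * x.val = psiBarProd x (n + 1) := by
  have hnat : Nat.Coprime u.natAbs z.natAbs := by
    have := Int.isCoprime_iff_gcd_eq_one.mp hcop
    rwa [Int.gcd_eq_natAbs] at this
  have hnum : ((u : ℚ) / z).num = u := Rat.num_div_eq_of_coprime hz hnat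
  have hden : ((((u : ℚ) / z).den : ℕ) : ℤ) = z := Rat.den_div_eq_of_coprime hz hnat
  have happrox' : |x.val - (((u : ℚ) / z : ℚ) : ℝ)| < 1 / (2 * ((((u : ℚ) / z).den : ℕ) : ℝ) ^ 2) := by
    have h1 : ((((u : ℚ) / z).den : ℕ) : ℝ) = z := by exact_mod_cast hden
    rw [h1]
    push_cast
    exact happrox
  obtain ⟨n, hn⟩ := Real.exists_rat_eq_convergent happrox'
  refine ⟨n, ?_, ?_⟩
  · have := num_sub_den_mul_conj hD h n
    rw [← hn, hnum] at this
    have h1 : ((((u : ℚ) / z).den : ℕ) : ℝ) = z := by exact_mod_cast hden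
    rwa [h1] at this
  · have := num_sub_den_mul_val hD h n
    rw [← hn, hnum] at this
    have h1 : ((((u : ℚ) / z).den : ℕ) : ℝ) = z := by exact_mod_cast hden
    rwa [h1] at this

end QuadIrr

end Literature.NumberTheory.QuadraticFields

end
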